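import Literature.MathematicalPhysics.QuantumFieldTheory.Balaban1983to89.B9SupplySockB9P3ZdFrame

/-!
# `Balaban1983to89.B9Eq343CutoffFamilyZd` — [Balaban1985BackgroundPropagators] (3.43) p. 398 «ζ ∈ C₀^∞(Δ̃(y)), y ∈ Λ_j … (‖ζ‖^ξ_β + |ζ|), ξ = L^{−j}»:
# THE CANONICAL LATTICE CUT-OFF OF A BLOCK — an explicit `ζ_y : ℤᵈ → [0,1]` supported in `Δ̃(y)`, equal to `1` on a core cube containing `Δ(y)`, with a linear
# ramp of width `⌊Lʲ∕4⌋ + 1`; its support, core, Lipschitz and far-pair facts; PRINT's ξ-scaled Hölder quotients of `ζ_y` are `≤ 4^β` (kernel), and the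
# frame's η-scale norm `cutHZd` of `ζ_y` is `≥ |x′−x|^{−β}` at the pair straddling the ramp (kernel) — the two readings of «‖ζ‖_β» side by side

statement-level skeleton of published theorems with citation tags; proofs where landed; nothing here is a claim about the
Yang–Mills mass gap

PDF held: `paper:balaban1985-cmp99-background-propagators` ([4] = B9; journal page = PDF page + 388): p. 397 («Δ̃(y) is a cube of the size 2Lʲη on the lattice
T_η with center at the point y»; (3.40) «It is understood that the η-scale is used in the above definitions. If we use another scale, then it is indicated
explicitly by a superscript, e.g. ‖·‖^ξ means that functions and distances are on the ξ-lattice»), p. 398 (3.43) (page IMAGE re-read by this seat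
2026-08-28: «·(‖ζ‖^ξ_β + |ζ|)e^{−δ₀d(y,y′)}|λ|, ξ = L^{−j}, for 0 ≤ β ≤ β₀ < 1, ζ ∈ C₀^∞(Δ̃(y)), y ∈ Λ_j, supp λ ⊂ Δ(y′)»).

WHY THIS FILE (cell `pub-ymgap`, HUMAN RULING D-0062 ∕ D-0149; seat `pub-ymgap-dag-n06-w2` (g2), node N06 = [B9]; INTENT-2; count-neutral).  The Hölder
summation `B9Eq343HolderGlobalFromLocalZd` (INTENT-1) turns (3.43) at the genuine readings into the global weighted Hölder bound for ANY cut-off family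
`ζ_y` supported in `Δ̃(y)`, and removes the cut-off on the pairs where `ζ_y = 1` at both points.  To USE it one needs an actual family: on the lattice
«C₀^∞(Δ̃(y))» is just «supported in Δ̃(y)», and the natural choice is the piecewise-linear tent — `1` on the cube `Δ(y)` widened by `⌊Lʲ∕4⌋`, decreasing
linearly in the sup-distance to that core over `⌊Lʲ∕4⌋ + 1` steps, `0` outside `Δ̃(y)`.  This file is that object with its elementary API, and the two numbers
the summation's exchange letter needs: print's ξ-scaled quotient of `ζ_y` is O(1) (`≤ 4^β`), while the frame's η-scale `cutHZd x.i.η β len ζ_y`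
(`B9SupplySockB9P3ZdFrame.cutHZd`, the `cutH` field of `geoZd`) is at least `|x′−x|^{−β} = ((⌊Lʲ∕4⌋+1)·η)^{−β}`-type at the pair straddling the ramp — the located
divergence (L-H2) of INTENT-1's docstring, in kernel form.

WHAT IS DECLARED ∕ PROVED (0 sorry; definition lane: FIVE small defs WITH BODY + theorems; no `instance`, no `notation`).
* §1 `boxDistZd lo hi z : ℕ` (sup-distance from `z` to the box `[lo, hi]`), `boxDistZd_eq_zero_iff` (`= 0 ↔ InBox`), `inBox_widen_of_boxDistZd_le`,
  `boxDistZd_le_add_linfDist` (1-Lipschitz in the sup-distance), `lt_boxDistZd_of_coord`.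
* §2 `rampZd L j := Lʲ ∕ 4` (ℕ), `coreLoZd ∕ coreHiZd L j y` (the corners of `Δ(y)` moved out by `rampZd`), `coreZd L j y` (the core cube), ★ `zetaZd L j y : ℤᵈ → ℝ`
  (`max 0 (1 − boxDist(z, core)∕(rampZd + 1))`); `blockZd_subset_coreZd`, `coreZd_subset_blockTZd`, `two_mul_rampZd_le`.
* §3 ★ `zetaZd_eq_one_of_mem_coreZd`, `zetaZd_eq_one_of_mem_blockZd`, `zetaZd_nonneg`, `zetaZd_le_one`, `abs_zetaZd_le_one`, ★ `mem_blockTZd_of_zetaZd_ne_zero`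
  («ζ_y ∈ C₀(Δ̃(y))» = the frame's `cutInT`, the hypothesis `hζ` of INTENT-1), ★ `abs_zetaZd_sub_le` (Lipschitz: `|ζ z − ζ z′| ≤ |z−z′|_∞ ∕ (rampZd + 1)`),
  ★ `rampZd_lt_linfDist` (FAR-PAIR GAP: `x ∈ Δ(y)`, `x′ ∉ core ⇒ ⌊Lʲ∕4⌋ < |x−x′|_∞`), `cutSupZd_zetaZd_le_one`, `linfDist_le_l1Len` (the tree's `l1Len` dominates
  the sup-distance, so the `len`-hypotheses below are met by it).
* §4 ★★ `xiScaled_hquot_zetaZd_le` — PRINT's «‖ζ‖^ξ_β», ξ = L^{−j}: `(Lʲη)^β·|ζ x′ − ζ x|∕(η·len(x′−x))^β ≤ 4^β` on EVERY admissible pair, `0 ≤ β ≤ 1`, for any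
  `len ≥ |·|_∞` — the ξ-scaled cut-off norm of (3.43) is O(1) for this family (what a ξ-scaled re-typing of `geoZd.cutH` would consume).
* §5 ★★ `le_cutHZd_zetaZd` — THE FRAME's η-SCALE READING, LOWER BOUND (LOCATED (L-H2), kernel form): at the pair `(z₀, z₀ − (rampZd+1)e_μ)` (core corner →
  outside the support; admissible whenever `η·len ≤ 1` there) `ζ` drops from `1` to `0`, so `cutHZd η β len ζ_y ≥ (η·len((rampZd+1)e_μ))^{−β}`; with
  `len = l1Len` this is `((⌊Lʲ∕4⌋+1)η)^{−β}` (`le_cutHZd_zetaZd_l1Len`) — growing like `(Lʲη)^{−β}` down the scales, where print's factor stays `≤ 4^β + 1`.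
HONEST SCOPE.  Elementary lattice geometry + two one-line estimates; nothing of [4] asserted; the choice «ramp width ⌊Lʲ∕4⌋ + 1» is this file's (any fixed
fraction of Lʲ would do; at `j = 0` the core is the single site `Δ(y)` and every pair is far).  §5 is a statement about the TYPED frame field `cutHZd`, not
about print; whether `geoZd.cutH` is re-typed ξ-scaled (e.g. `Cut := 𝔅 × (ℤᵈ → ℝ)` so the block index is available to `cutH`) is the frame owner's call —
INTENT-1's theorems are agnostic.  Count-neutral; N05∕N06 NOT discharged; one finite lattice programme at fixed `ε`; R4 closes the conditional finite-𝕋⁴ rung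
`BalabanLadder.UV` only; nothing continuum ∕ ℝ⁴ ∕ OS ∕ mass-gap ∕ Clay.  Unit `pub-ymgap-dag-n06-w2` (g2), 2026-08-28.
-/

noncomputable section

namespace Literature.MathematicalPhysics.QuantumFieldTheory.Balaban1983to89.B9Eq343CutoffFamilyZd

open B7Prop1Local (InBox)
open B7Prop1Explicit (e l1 l1_zsmul_e)
open B8Ineq130 (tlo thi)
open B9Eq340HolderZd (AdmPair l1Len)
open B9SupplySockB9P3ZdFrame (blockZd blockTZd cutHZd cutSupZd)
open LatticeNorms (linfDist natAbs_sub_le_linfDist linfDist_le_iff)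

-- `Site` alone could resolve to the torus sites of `Setup.lean`; re-export the `ℤ^d` sites of `B7Prop1Explicit`.
export B7Prop1Explicit (Site)

variable {d : ℕ}

/-! ## §1 The sup-distance from a site to a box -/

/-- **the sup-distance from `z` to the box `[lo, hi]`** (lattice units): `max_μ max{(lo_μ − z_μ)₊, (z_μ − hi_μ)₊}`.
[cite: Balaban1985BackgroundPropagators, p.397 (Δ(y), Δ̃(y) are cubes; bookkeeping)] -/
def boxDistZd (lo hi z : Site d) : ℕ :=
  Finset.univ.sup fun μ => max (lo μ - z μ).toNat (z μ - hi μ).toNat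

/-- each coordinate's excess is below the sup-distance. [cite: Balaban1985BackgroundPropagators, p.397 (bookkeeping)] -/
theorem coord_le_boxDistZd (lo hi z : Site d) (μ : Fin d) : max (lo μ - z μ).toNat (z μ - hi μ).toNat ≤ boxDistZd lo hi z :=
  Finset.le_sup (f := fun μ => max (lo μ - z μ).toNat (z μ - hi μ).toNat) (Finset.mem_univ μ)

/-- `boxDist ≤ n` iff every coordinate excess is `≤ n`. [cite: Balaban1985BackgroundPropagators, p.397 (bookkeeping)] -/
theorem boxDistZd_le_iff (lo hi z : Site d) (n : ℕ) :
    boxDistZd lo hi z ≤ n ↔ ∀ μ, max (lo μ - z μ).toNat (z μ - hi μ).toNat ≤ n := by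
  simp [boxDistZd, Finset.sup_le_iff]

/-- **the sup-distance to the box vanishes exactly on the box.** [cite: Balaban1985BackgroundPropagators, p.397 (bookkeeping)] -/
theorem boxDistZd_eq_zero_iff (lo hi z : Site d) : boxDistZd lo hi z = 0 ↔ InBox lo hi z := by
  rw [← Nat.le_zero, boxDistZd_le_iff]
  refine forall_congr' fun μ => ?_
  simp only [Nat.le_zero, Nat.max_eq_zero_iff, Int.toNat_eq_zero]
  constructor
  · rintro ⟨h1, h2⟩; exact ⟨by omega, by omega⟩
  · rintro ⟨h1, h2⟩; exact ⟨by omega, by omega⟩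

/-- a site at sup-distance `≤ n` from the box lies in the box widened by `n`. [cite: Balaban1985BackgroundPropagators, p.397 (bookkeeping)] -/
theorem inBox_widen_of_boxDistZd_le {lo hi z : Site d} {n : ℕ} (h : boxDistZd lo hi z ≤ n) :
    InBox (fun μ => lo μ - n) (fun μ => hi μ + n) z := by
  rw [boxDistZd_le_iff] at h
  intro μ
  have h1 := h μ
  rw [max_le_iff] at h1
  obtain ⟨ha, hb⟩ := h1
  have ha' : lo μ - z μ ≤ n := (Int.toNat_le.mp ha)
  have hb' : z μ - hi μ ≤ n := (Int.toNat_le.mp hb)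
  constructor <;> dsimp only <;> omega

/-- **the sup-distance to a box is 1-Lipschitz in the sup-distance between sites**: `boxDist z ≤ boxDist z′ + |z − z′|_∞`.
[cite: Balaban1985BackgroundPropagators, p.397 (bookkeeping)] -/
theorem boxDistZd_le_add_linfDist (lo hi z z' : Site d) : boxDistZd lo hi z ≤ boxDistZd lo hi z' + linfDist z z' := by
  rw [boxDistZd_le_iff]
  intro μ
  have h1 := coord_le_boxDistZd lo hi z' μ
  have h2 := natAbs_sub_le_linfDist z z' μ
  rw [max_le_iff] at h1 ⊢
  obtain ⟨ha, hb⟩ := h1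
  have ha' := Int.toNat_le.mp ha
  have hb' := Int.toNat_le.mp hb
  have h2' : |z μ - z' μ| ≤ (linfDist z z' : ℤ) := by
    rw [← Int.natCast_natAbs]; exact_mod_cast h2
  rw [abs_le] at h2'
  constructor
  · refine Int.toNat_le.mpr ?_; push_cast; omega
  · refine Int.toNat_le.mpr ?_; push_cast; omega

/-- a site whose `μ`-th coordinate is below `lo_μ − n` (or above `hi_μ + n`) is at sup-distance `> n` from the box.
[cite: Balaban1985BackgroundPropagators, p.397 (bookkeeping)] -/
theorem lt_boxDistZd_of_coord {lo hi z : Site d} {n : ℕ} {μ : Fin d} (h : z μ < lo μ - n ∨ hi μ + n < z μ) : n < boxDistZd lo hi z := by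
  refine lt_of_lt_of_le ?_ (coord_le_boxDistZd lo hi z μ)
  rw [lt_max_iff]
  rcases h with h | h
  · left; have : (n : ℤ) < lo μ - z μ := by omega
    exact (Int.lt_toNat.mpr this)
  · right; have : (n : ℤ) < z μ - hi μ := by omega
    exact (Int.lt_toNat.mpr this)

/-! ## §2 The core cube and the cut-off -/

/-- **the ramp width parameter `⌊Lʲ∕4⌋`** (the core is `Δ(y)` widened by this many sites; the tent descends over `⌊Lʲ∕4⌋ + 1` steps).
[cite: Balaban1985BackgroundPropagators, p.397 («Δ̃(y) is a cube of the size 2Lʲη»)] -/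
def rampZd (L j : ℕ) : ℕ := L ^ j / 4

/-- `2·⌊Lʲ∕4⌋ ≤ ⌊Lʲ∕2⌋` and `2·⌊Lʲ∕4⌋ ≤ Lʲ − ⌊Lʲ∕2⌋` — the core widened once more by the ramp still lies in `Δ̃(y)`.
[cite: Balaban1985BackgroundPropagators, p.397 (bookkeeping)] -/
theorem two_mul_rampZd_le (L j : ℕ) : 2 * rampZd L j ≤ L ^ j / 2 ∧ 2 * rampZd L j ≤ L ^ j - L ^ j / 2 := by
  unfold rampZd
  constructor <;> omega

/-- the lower corner of the core: the lower corner of `Δ(y)` moved down by `⌊Lʲ∕4⌋`. [cite: Balaban1985BackgroundPropagators, p.397 (bookkeeping)] -/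
def coreLoZd (L j : ℕ) (y : Site d) : Site d := fun μ => tlo L y j μ - rampZd L j

/-- the upper corner of the core: the upper corner of `Δ(y)` moved up by `⌊Lʲ∕4⌋`. [cite: Balaban1985BackgroundPropagators, p.397 (bookkeeping)] -/
def coreHiZd (L j : ℕ) (y : Site d) : Site d := fun μ => thi L y j μ + rampZd L j

/-- **the core cube**: `Δ(y)` widened by `⌊Lʲ∕4⌋` sites in every direction — the region where the cut-off is `1`.
[cite: Balaban1985BackgroundPropagators, p.397 (Δ(y) ⊂ Δ̃(y))] -/
def coreZd (L j : ℕ) (y : Site d) : Set (Site d) :=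
  {z | InBox (coreLoZd L j y) (coreHiZd L j y) z}

/-- ★ **THE CANONICAL LATTICE CUT-OFF `ζ_y`** of the block `Δ(y)` (`y` of level `j`): `ζ_y(z) = max{0, 1 − dist_∞(z, core)∕(⌊Lʲ∕4⌋ + 1)}` — `1` on the core, a
linear ramp, `0` from sup-distance `⌊Lʲ∕4⌋ + 1` on (so inside `Δ̃(y)`); the lattice stand-in for print's «ζ ∈ C₀^∞(Δ̃(y))».
[cite: Balaban1985BackgroundPropagators, (3.43) p.398, p.397] -/
def zetaZd (L j : ℕ) (y : Site d) (z : Site d) : ℝ :=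
  max 0 (1 - (boxDistZd (coreLoZd L j y) (coreHiZd L j y) z : ℝ) / ((rampZd L j : ℝ) + 1))

/-- membership in the core, unfolded. [cite: Balaban1985BackgroundPropagators, p.397 (bookkeeping)] -/
theorem mem_coreZd_iff (L j : ℕ) (y z : Site d) : z ∈ coreZd L j y ↔ InBox (coreLoZd L j y) (coreHiZd L j y) z := Iff.rfl

/-- **Δ(y) ⊂ core**. [cite: Balaban1985BackgroundPropagators, p.397 (Δ(y) ⊂ Δ̃(y))] -/
theorem blockZd_subset_coreZd (L j : ℕ) (y : Site d) : blockZd L j y ⊆ coreZd L j y := by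
  intro z hz μ
  obtain ⟨h1, h2⟩ := hz μ
  have h0 : (0 : ℤ) ≤ (rampZd L j : ℤ) := by positivity
  simp only [coreLoZd, coreHiZd]
  constructor <;> omega

/-- **the core widened by the ramp lies in Δ̃(y)**: `InBox (coreLo − n) (coreHi + n) z → z ∈ Δ̃(y)` for `n ≤ ⌊Lʲ∕4⌋`.
[cite: Balaban1985BackgroundPropagators, p.397 («Δ̃(y) is a cube of the size 2Lʲη … with center at the point y»)] -/
theorem mem_blockTZd_of_inBox_widen {L j : ℕ} {y z : Site d} {n : ℕ} (hn : n ≤ rampZd L j)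
    (h : InBox (fun μ => coreLoZd L j y μ - n) (fun μ => coreHiZd L j y μ + n) z) : z ∈ blockTZd L j y := by
  obtain ⟨hA, hB⟩ := two_mul_rampZd_le L j
  have hle : L ^ j / 2 ≤ L ^ j := Nat.div_le_self _ _
  have hA' : 2 * (rampZd L j : ℤ) ≤ (L : ℤ) ^ j / 2 := by
    have h' : ((2 * rampZd L j : ℕ) : ℤ) ≤ ((L ^ j / 2 : ℕ) : ℤ) := by exact_mod_cast hA
    push_cast at h'
    exact h'
  have hB' : 2 * (rampZd L j : ℤ) ≤ (L : ℤ) ^ j - (L : ℤ) ^ j / 2 := by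
    have h' : ((2 * rampZd L j : ℕ) : ℤ) ≤ ((L ^ j - L ^ j / 2 : ℕ) : ℤ) := by exact_mod_cast hB
    rw [Nat.cast_sub hle] at h'
    push_cast at h'
    exact h'
  have hn' : (n : ℤ) ≤ (rampZd L j : ℤ) := by exact_mod_cast hn
  intro μ
  obtain ⟨h1, h2⟩ := h μ
  simp only [coreLoZd, coreHiZd] at h1 h2
  constructor <;> dsimp only <;> omega

/-- **core ⊂ Δ̃(y)**. [cite: Balaban1985BackgroundPropagators, p.397 (Δ(y) ⊂ Δ̃(y))] -/
theorem coreZd_subset_blockTZd (L j : ℕ) (y : Site d) : coreZd L j y ⊆ blockTZd L j y := by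
  intro z hz
  refine mem_blockTZd_of_inBox_widen (n := 0) (Nat.zero_le _) fun μ => ?_
  simpa using hz μ

/-! ## §3 The cut-off: values, support, Lipschitz, the far-pair gap -/

/-- ★ **`ζ_y = 1` on the core.** [cite: Balaban1985BackgroundPropagators, (3.43) p.398 (the cut-off)] -/
theorem zetaZd_eq_one_of_mem_coreZd {L j : ℕ} {y z : Site d} (hz : z ∈ coreZd L j y) : zetaZd L j y z = 1 := by
  have h0 : boxDistZd (coreLoZd L j y) (coreHiZd L j y) z = 0 := (boxDistZd_eq_zero_iff _ _ _).mpr hz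
  simp [zetaZd, h0]

/-- **`ζ_y = 1` on `Δ(y)`** (the pairs inside the block see no cut-off). [cite: Balaban1985BackgroundPropagators, (3.43) p.398] -/
theorem zetaZd_eq_one_of_mem_blockZd {L j : ℕ} {y z : Site d} (hz : z ∈ blockZd L j y) : zetaZd L j y z = 1 :=
  zetaZd_eq_one_of_mem_coreZd (blockZd_subset_coreZd L j y hz)

/-- `0 ≤ ζ_y`. [cite: Balaban1985BackgroundPropagators, (3.43) p.398 (bookkeeping)] -/
theorem zetaZd_nonneg (L j : ℕ) (y z : Site d) : 0 ≤ zetaZd L j y z := le_max_left _ _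

/-- `ζ_y ≤ 1`. [cite: Balaban1985BackgroundPropagators, (3.43) p.398 (bookkeeping)] -/
theorem zetaZd_le_one (L j : ℕ) (y z : Site d) : zetaZd L j y z ≤ 1 := by
  refine max_le zero_le_one ?_
  have h : 0 ≤ (boxDistZd (coreLoZd L j y) (coreHiZd L j y) z : ℝ) / ((rampZd L j : ℝ) + 1) := by positivity
  linarith

/-- `|ζ_y| ≤ 1` (so `|ζ| ≤ 1` in (3.43)'s factor). [cite: Balaban1985BackgroundPropagators, (3.43) p.398 (bookkeeping)] -/
theorem abs_zetaZd_le_one (L j : ℕ) (y z : Site d) : |zetaZd L j y z| ≤ 1 := by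
  rw [abs_of_nonneg (zetaZd_nonneg L j y z)]
  exact zetaZd_le_one L j y z

/-- ★ **«ζ_y ∈ C₀(Δ̃(y))»**: `ζ_y(z) ≠ 0 ⇒ z ∈ Δ̃(y)` — the frame's `cutInT` ∕ INTENT-1's hypothesis `hζ`. [cite: Balaban1985BackgroundPropagators, (3.43) p.398 («ζ ∈ C₀^∞(Δ̃(y))»), p.397] -/
theorem mem_blockTZd_of_zetaZd_ne_zero {L j : ℕ} {y z : Site d} (hz : zetaZd L j y z ≠ 0) : z ∈ blockTZd L j y := by
  have hlt : boxDistZd (coreLoZd L j y) (coreHiZd L j y) z ≤ rampZd L j := by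
    by_contra hgt
    push Not at hgt
    have hge : (rampZd L j : ℝ) + 1 ≤ (boxDistZd (coreLoZd L j y) (coreHiZd L j y) z : ℝ) := by exact_mod_cast hgt
    have hpos : (0 : ℝ) < (rampZd L j : ℝ) + 1 := by positivity
    have h1 : 1 ≤ (boxDistZd (coreLoZd L j y) (coreHiZd L j y) z : ℝ) / ((rampZd L j : ℝ) + 1) := by
      rw [le_div_iff₀ hpos, one_mul]; exact hge
    exact hz (by unfold zetaZd; exact max_eq_left (by linarith))
  exact mem_blockTZd_of_inBox_widen hlt (inBox_widen_of_boxDistZd_le le_rfl)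

/-- ★ **LIPSCHITZ**: `|ζ_y(z) − ζ_y(z′)| ≤ |z − z′|_∞ ∕ (⌊Lʲ∕4⌋ + 1)` (a tent over a 1-Lipschitz distance).
[cite: Balaban1985BackgroundPropagators, (3.43) p.398 (‖ζ‖_β), (3.40) p.397] -/
theorem abs_zetaZd_sub_le (L j : ℕ) (y z z' : Site d) :
    |zetaZd L j y z - zetaZd L j y z'| ≤ (linfDist z z' : ℝ) / ((rampZd L j : ℝ) + 1) := by
  have hW : (0 : ℝ) < (rampZd L j : ℝ) + 1 := by positivity
  have h1 : (boxDistZd (coreLoZd L j y) (coreHiZd L j y) z : ℝ) ≤ boxDistZd (coreLoZd L j y) (coreHiZd L j y) z' + linfDist z z' := by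
    exact_mod_cast boxDistZd_le_add_linfDist _ _ z z'
  have h2 : (boxDistZd (coreLoZd L j y) (coreHiZd L j y) z' : ℝ) ≤ boxDistZd (coreLoZd L j y) (coreHiZd L j y) z + linfDist z z' := by
    have := boxDistZd_le_add_linfDist (coreLoZd L j y) (coreHiZd L j y) z' z
    rw [LatticeNorms.linfDist_comm] at this
    exact_mod_cast this
  -- `|max 0 a − max 0 b| ≤ |a − b|`
  have hmax : ∀ a b : ℝ, |max 0 a - max 0 b| ≤ |a - b| := fun a b => abs_max_sub_max_le_max 0 a 0 b |>.trans (by simp)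
  unfold zetaZd
  refine (hmax _ _).trans ?_
  rw [abs_le]
  constructor
  · have : (boxDistZd (coreLoZd L j y) (coreHiZd L j y) z : ℝ) / ((rampZd L j : ℝ) + 1) -
        (boxDistZd (coreLoZd L j y) (coreHiZd L j y) z' : ℝ) / ((rampZd L j : ℝ) + 1) ≤ (linfDist z z' : ℝ) / ((rampZd L j : ℝ) + 1) := by
      rw [← sub_div]; exact div_le_div_of_nonneg_right (by linarith) hW.le
    linarith
  · have : (boxDistZd (coreLoZd L j y) (coreHiZd L j y) z' : ℝ) / ((rampZd L j : ℝ) + 1) -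
        (boxDistZd (coreLoZd L j y) (coreHiZd L j y) z : ℝ) / ((rampZd L j : ℝ) + 1) ≤ (linfDist z z' : ℝ) / ((rampZd L j : ℝ) + 1) := by
      rw [← sub_div]; exact div_le_div_of_nonneg_right (by linarith) hW.le
    linarith

/-- ★ **THE FAR-PAIR GAP**: a site of `Δ(y)` and a site outside the core are more than `⌊Lʲ∕4⌋` apart in the sup-distance (so a pair leaving the core is at
least a quarter of a block long — the threshold at which INTENT-1's far-pair road takes over). [cite: Balaban1985BackgroundPropagators, p.397 (Δ(y), Δ̃(y)), (3.40) p.397] -/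
theorem rampZd_lt_linfDist {L j : ℕ} {y x x' : Site d} (hx : x ∈ blockZd L j y) (hx' : x' ∉ coreZd L j y) : rampZd L j < linfDist x x' := by
  rw [mem_coreZd_iff] at hx'
  simp only [InBox, not_forall, not_and_or, not_le] at hx'
  obtain ⟨μ, hμ⟩ := hx'
  obtain ⟨h1, h2⟩ := hx μ
  have h3 := natAbs_sub_le_linfDist x x' μ
  have h4 : (rampZd L j : ℤ) < ((x μ - x' μ).natAbs : ℤ) := by
    rw [Int.natCast_natAbs]
    simp only [coreLoZd, coreHiZd] at hμ
    rcases hμ with h | h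
    · rw [lt_abs]; left; omega
    · rw [lt_abs]; right; omega
  exact_mod_cast (show (rampZd L j : ℤ) < (linfDist x x' : ℤ) by exact lt_of_lt_of_le h4 (by exact_mod_cast h3))

/-- `|ζ_y| ≤ 1` as the frame's sup `cutSupZd ζ_y ≤ 1`. [cite: Balaban1985BackgroundPropagators, (3.43) p.398 («|ζ|»)] -/
theorem cutSupZd_zetaZd_le_one (L j : ℕ) (y : Site d) : cutSupZd (zetaZd L j y) ≤ 1 :=
  Real.iSup_le (fun z => abs_zetaZd_le_one L j y z) zero_le_one

/-- **the tree's `l1Len` dominates the sup-distance**: `|z − z′|_∞ ≤ |z′ − z|₁` — so every `len`-hypothesis below is met by `len := l1Len`.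
[cite: Balaban1985BackgroundPropagators, (3.40) p.397 (the norm |x − x′| on the lattice)] -/
theorem linfDist_le_l1Len (z z' : Site d) : (linfDist z z' : ℝ) ≤ l1Len (z' - z) := by
  unfold B9Eq340HolderZd.l1Len
  have h : linfDist z z' ≤ l1 (z' - z) := by
    rw [linfDist_le_iff]
    intro μ
    have h1 : (z μ - z' μ).natAbs = ((z' - z) μ).natAbs := by
      rw [Pi.sub_apply, ← Int.natAbs_neg, neg_sub]
    rw [h1]
    exact Finset.single_le_sum (f := fun κ => ((z' - z) κ).natAbs) (fun _ _ => Nat.zero_le _) (Finset.mem_univ μ)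
  exact_mod_cast h

/-! ## §4 Print's ξ-scaled Hölder quotient of `ζ_y` is O(1) -/

/-- `Lʲ ≤ 4·(⌊Lʲ∕4⌋ + 1)`: the block scale is at most four ramp widths. [cite: Balaban1985BackgroundPropagators, p.397 (bookkeeping)] -/
theorem pow_le_four_mul_rampZd_succ (L j : ℕ) : (L : ℝ) ^ j ≤ 4 * ((rampZd L j : ℝ) + 1) := by
  have h : L ^ j ≤ 4 * (rampZd L j + 1) := by unfold rampZd; omega
  exact_mod_cast h

/-- ★★ **PRINT's ξ-SCALED QUOTIENT OF `ζ_y` IS O(1)** ((3.43) «‖ζ‖^ξ_β, ξ = L^{−j}»: distances on the ξ-lattice = η-distances × (Lʲη)⁻¹): for `0 ≤ β ≤ 1`, `η > 0`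
and any admissible pair `(x, x′)` (`0 < len`, `η·len ≤ 1`) of a length function dominating the sup-distance,
`(Lʲη)^β · |ζ_y(x′) − ζ_y(x)| ∕ (η·len(x′−x))^β ≤ 4^β`.  (Short pairs: the Lipschitz bound; long pairs: `|ζ| ≤ 1`.)
[cite: Balaban1985BackgroundPropagators, (3.43) p.398, (3.40) p.397] -/
theorem xiScaled_hquot_zetaZd_le {L : ℕ} (j : ℕ) (y : Site d) {η β : ℝ} (hη : 0 < η) (hβ0 : 0 ≤ β) (hβ1 : β ≤ 1)
    {len : Site d → ℝ} (hlen : ∀ z z' : Site d, (linfDist z z' : ℝ) ≤ len (z' - z))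
    {p : Site d × Site d} (hp : p ∈ AdmPair η len) :
    ((L : ℝ) ^ j * η) ^ β * (|zetaZd L j y p.2 - zetaZd L j y p.1| / (η * len (p.2 - p.1)) ^ β) ≤ (4 : ℝ) ^ β := by
  -- letters: `W` the ramp width, `s` the pair length (η-scale), `t` the block scale
  set W : ℝ := (rampZd L j : ℝ) + 1 with hWdef
  have hW : 0 < W := by rw [hWdef]; positivity
  have hs : 0 < η * len (p.2 - p.1) := mul_pos hη hp.1
  set s : ℝ := η * len (p.2 - p.1) with hsdef
  have ht : 0 ≤ (L : ℝ) ^ j * η := by positivity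
  have htW : (L : ℝ) ^ j * η ≤ 4 * (W * η) := by
    have := pow_le_four_mul_rampZd_succ L j
    nlinarith
  have hquo : ((L : ℝ) ^ j * η) / (W * η) ≤ 4 := by rw [div_le_iff₀ (mul_pos hW hη)]; exact htW
  have hquo0 : 0 ≤ ((L : ℝ) ^ j * η) / (W * η) := div_nonneg ht (mul_pos hW hη).le
  -- the two bounds on the difference
  have hdiff1 : |zetaZd L j y p.2 - zetaZd L j y p.1| ≤ 1 := by
    rw [abs_le]
    have a1 := zetaZd_nonneg L j y p.1; have a2 := zetaZd_le_one L j y p.1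
    have b1 := zetaZd_nonneg L j y p.2; have b2 := zetaZd_le_one L j y p.2
    constructor <;> linarith
  have hdiff2 : |zetaZd L j y p.2 - zetaZd L j y p.1| ≤ s / (W * η) := by
    have h1 := abs_zetaZd_sub_le L j y p.2 p.1
    have h2 : (linfDist p.2 p.1 : ℝ) ≤ len (p.2 - p.1) := by
      have := hlen p.1 p.2
      rw [LatticeNorms.linfDist_comm] at this
      exact this
    calc |zetaZd L j y p.2 - zetaZd L j y p.1| ≤ (linfDist p.2 p.1 : ℝ) / W := h1
      _ ≤ len (p.2 - p.1) / W := div_le_div_of_nonneg_right h2 hW.le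
      _ = s / (W * η) := by rw [hsdef]; field_simp
  have hsβ : 0 < s ^ β := Real.rpow_pos_of_pos hs β
  by_cases hcase : W * η ≤ s
  · -- long pairs: `|Δζ| ≤ 1`, `t^β ∕ s^β ≤ (t∕(Wη))^β ≤ 4^β`
    calc ((L : ℝ) ^ j * η) ^ β * (|zetaZd L j y p.2 - zetaZd L j y p.1| / s ^ β)
        ≤ ((L : ℝ) ^ j * η) ^ β * (1 / s ^ β) :=
          mul_le_mul_of_nonneg_left (div_le_div_of_nonneg_right hdiff1 hsβ.le) (Real.rpow_nonneg ht β)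
      _ = (((L : ℝ) ^ j * η) / s) ^ β := by rw [Real.div_rpow ht hs.le, mul_one_div]
      _ ≤ (((L : ℝ) ^ j * η) / (W * η)) ^ β := by
          refine Real.rpow_le_rpow (div_nonneg ht hs.le) ?_ hβ0
          exact div_le_div_of_nonneg_left ht (mul_pos hW hη) hcase
      _ ≤ (4 : ℝ) ^ β := Real.rpow_le_rpow hquo0 hquo hβ0
  · -- short pairs: `|Δζ| ≤ s∕(Wη)`, `t^β·s^{1−β}∕(Wη) ≤ (t∕(Wη))^β ≤ 4^β`
    push Not at hcase
    have hWη : 0 < W * η := mul_pos hW hη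
    have h1 : ((L : ℝ) ^ j * η) ^ β * (|zetaZd L j y p.2 - zetaZd L j y p.1| / s ^ β) ≤
        ((L : ℝ) ^ j * η) ^ β * ((s / (W * η)) / s ^ β) :=
      mul_le_mul_of_nonneg_left (div_le_div_of_nonneg_right hdiff2 hsβ.le) (Real.rpow_nonneg ht β)
    have h2 : (s / (W * η)) / s ^ β = s ^ (1 - β) / (W * η) := by
      rw [Real.rpow_sub hs, Real.rpow_one]; field_simp
    have h3 : s ^ (1 - β) ≤ (W * η) ^ (1 - β) := Real.rpow_le_rpow hs.le hcase.le (by linarith)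
    have h4 : ((L : ℝ) ^ j * η) ^ β * (s ^ (1 - β) / (W * η)) ≤ ((L : ℝ) ^ j * η) ^ β * ((W * η) ^ (1 - β) / (W * η)) :=
      mul_le_mul_of_nonneg_left (div_le_div_of_nonneg_right h3 hWη.le) (Real.rpow_nonneg ht β)
    have h5 : ((L : ℝ) ^ j * η) ^ β * ((W * η) ^ (1 - β) / (W * η)) = (((L : ℝ) ^ j * η) / (W * η)) ^ β := by
      rw [Real.div_rpow ht hWη.le, Real.rpow_sub hWη, Real.rpow_one]
      field_simp
    calc ((L : ℝ) ^ j * η) ^ β * (|zetaZd L j y p.2 - zetaZd L j y p.1| / s ^ β)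
        ≤ ((L : ℝ) ^ j * η) ^ β * (s ^ (1 - β) / (W * η)) := by rw [← h2]; exact h1
      _ ≤ (((L : ℝ) ^ j * η) / (W * η)) ^ β := by rw [← h5]; exact h4
      _ ≤ (4 : ℝ) ^ β := Real.rpow_le_rpow hquo0 hquo hβ0

/-! ## §5 The frame's η-scale norm of `ζ_y`: the lower bound at the pair straddling the ramp -/

/-- the core's lower corner is in the core (so `ζ_y = 1` there). [cite: Balaban1985BackgroundPropagators, p.397 (bookkeeping)] -/
theorem coreLoZd_mem_coreZd {L : ℕ} (hL : 1 ≤ L) (j : ℕ) (y : Site d) : coreLoZd L j y ∈ coreZd L j y := by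
  intro μ
  have h := B8Ineq130.tlo_le_thi hL (le_refl y) j μ
  have h0 : (0 : ℤ) ≤ (rampZd L j : ℤ) := by positivity
  simp only [coreLoZd, coreHiZd]
  constructor <;> omega

/-- one ramp width below the core's lower corner the cut-off vanishes. [cite: Balaban1985BackgroundPropagators, (3.43) p.398 (bookkeeping)] -/
theorem zetaZd_step_eq_zero (L j : ℕ) (y : Site d) (μ : Fin d) :
    zetaZd L j y (coreLoZd L j y - ((rampZd L j : ℤ) + 1) • e μ) = 0 := by
  have hlt : rampZd L j < boxDistZd (coreLoZd L j y) (coreHiZd L j y) (coreLoZd L j y - ((rampZd L j : ℤ) + 1) • e μ) := by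
    refine lt_boxDistZd_of_coord (μ := μ) (Or.inl ?_)
    simp [B7Prop1Explicit.e]
  have hge : (rampZd L j : ℝ) + 1 ≤ (boxDistZd (coreLoZd L j y) (coreHiZd L j y) (coreLoZd L j y - ((rampZd L j : ℤ) + 1) • e μ) : ℝ) := by
    exact_mod_cast hlt
  have hpos : (0 : ℝ) < (rampZd L j : ℝ) + 1 := by positivity
  unfold zetaZd
  refine max_eq_left ?_
  rw [sub_nonpos, le_div_iff₀ hpos, one_mul]
  exact hge

/-- ★★ **THE η-SCALE READING OF «‖ζ‖_β», LOWER BOUND (LOCATED (L-H2), kernel form)**: the frame's `cutHZd η β len ζ_y` — the sup of `|ζ(x′) − ζ(x)|∕(η·len)^β`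
over ALL admissible pairs plus `sup|ζ|` — is at least `(η·len(x′−x))^{−β}` at the pair `x = ` core corner, `x′ = x − (⌊Lʲ∕4⌋+1)e_μ` (where `ζ_y` drops from `1`
to `0`), whenever that pair is admissible; `len ≥ 1` on admissible displacements makes the family bounded (the real `iSup` is then a supremum).  For
`len = l1Len` the bound reads `((⌊Lʲ∕4⌋+1)·η)^{−β}` (`le_cutHZd_zetaZd_l1Len`) — of order `(Lʲη)^{−β}`, against print's O(1) ξ-scaled factor
(`xiScaled_hquot_zetaZd_le`). [cite: Balaban1985BackgroundPropagators, (3.43) p.398, (3.40) p.397] -/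
theorem le_cutHZd_zetaZd {L : ℕ} (hL : 1 ≤ L) (j : ℕ) (y : Site d) {η β : ℝ} (hη : 0 < η) (hβ0 : 0 ≤ β)
    {len : Site d → ℝ} (hlen1 : ∀ v : Site d, 0 < len v → 1 ≤ len v) (μ : Fin d)
    (hadm : (coreLoZd L j y, coreLoZd L j y - ((rampZd L j : ℤ) + 1) • e μ) ∈ AdmPair η len) :
    ((η * len (-(((rampZd L j : ℤ) + 1) • e μ))) ^ β)⁻¹ ≤ cutHZd η β len (zetaZd L j y) := by
  have hsup0 : 0 ≤ cutSupZd (zetaZd L j y) := Real.iSup_nonneg fun _ => abs_nonneg _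
  -- the Hölder family of `ζ_y` is bounded: every quotient is `≤ η^{−β}`
  have hbdd : BddAbove (Set.range fun p : AdmPair η len =>
      |zetaZd L j y p.1.2 - zetaZd L j y p.1.1| / (η * len (p.1.2 - p.1.1)) ^ β) := by
    refine ⟨(η ^ β)⁻¹, ?_⟩
    rintro _ ⟨p, rfl⟩
    have hp : (p : Site d × Site d) ∈ AdmPair η len := p.2
    have hD : η ^ β ≤ (η * len (p.1.2 - p.1.1)) ^ β := by
      refine Real.rpow_le_rpow hη.le ?_ hβ0
      have := hlen1 _ hp.1
      nlinarith
    have hηβ : 0 < η ^ β := Real.rpow_pos_of_pos hη β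
    have hdiff : |zetaZd L j y p.1.2 - zetaZd L j y p.1.1| ≤ 1 := by
      rw [abs_le]
      have a1 := zetaZd_nonneg L j y p.1.1; have a2 := zetaZd_le_one L j y p.1.1
      have b1 := zetaZd_nonneg L j y p.1.2; have b2 := zetaZd_le_one L j y p.1.2
      constructor <;> linarith
    calc |zetaZd L j y p.1.2 - zetaZd L j y p.1.1| / (η * len (p.1.2 - p.1.1)) ^ β ≤ 1 / (η * len (p.1.2 - p.1.1)) ^ β :=
          div_le_div_of_nonneg_right hdiff (hηβ.le.trans hD)
      _ ≤ 1 / η ^ β := div_le_div_of_nonneg_left zero_le_one hηβ hD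
      _ = (η ^ β)⁻¹ := one_div _
  have hterm : ((η * len (-(((rampZd L j : ℤ) + 1) • e μ))) ^ β)⁻¹ ≤
      ⨆ p : AdmPair η len, |zetaZd L j y p.1.2 - zetaZd L j y p.1.1| / (η * len (p.1.2 - p.1.1)) ^ β := by
    have h := le_ciSup hbdd ⟨(coreLoZd L j y, coreLoZd L j y - ((rampZd L j : ℤ) + 1) • e μ), hadm⟩
    refine le_trans (le_of_eq ?_) h
    dsimp only
    rw [zetaZd_step_eq_zero, zetaZd_eq_one_of_mem_coreZd (coreLoZd_mem_coreZd hL j y), zero_sub, abs_neg, abs_one, one_div,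
      sub_sub_cancel_left]
  unfold B9SupplySockB9P3ZdFrame.cutHZd
  linarith

/-- the `l1` length of the straddling displacement is the ramp width. [cite: Balaban1985BackgroundPropagators, (3.40) p.397 (bookkeeping)] -/
theorem l1Len_rampStep (L j : ℕ) (μ : Fin d) : l1Len (-(((rampZd L j : ℤ) + 1) • e μ) : Site d) = (rampZd L j : ℝ) + 1 := by
  unfold B9Eq340HolderZd.l1Len
  rw [← neg_zsmul, l1_zsmul_e]
  have h : (-((rampZd L j : ℤ) + 1)).natAbs = rampZd L j + 1 := by omega
  rw [h]; push_cast; ring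

/-- ★ **WITH `len = l1Len`**: `cutHZd η β l1Len ζ_y ≥ ((⌊Lʲ∕4⌋+1)·η)^{−β}` as soon as `(⌊Lʲ∕4⌋+1)·η ≤ 1` (the straddling pair is admissible) — the η-scale
reading of the cut-off factor grows like `(Lʲη)^{−β}` down the scales. [cite: Balaban1985BackgroundPropagators, (3.43) p.398, (3.40) p.397] -/
theorem le_cutHZd_zetaZd_l1Len {L : ℕ} (hL : 1 ≤ L) (j : ℕ) (y : Site d) {η β : ℝ} (hη : 0 < η) (hβ0 : 0 ≤ β) (μ : Fin d)
    (hsmall : ((rampZd L j : ℝ) + 1) * η ≤ 1) :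
    ((((rampZd L j : ℝ) + 1) * η) ^ β)⁻¹ ≤ cutHZd η β l1Len (zetaZd L j y) := by
  have hadm : (coreLoZd L j y, coreLoZd L j y - ((rampZd L j : ℤ) + 1) • e μ) ∈ AdmPair η (l1Len (d := d)) := by
    rw [B9Eq340HolderZd.mem_admPair]
    dsimp only
    rw [sub_sub_cancel_left, l1Len_rampStep]
    constructor
    · positivity
    · rw [mul_comm]; exact hsmall
  have h := le_cutHZd_zetaZd hL j y hη hβ0 (fun v hv => B9Eq340HolderZd.one_le_l1Len hv) μ hadm
  rw [l1Len_rampStep, mul_comm] at h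
  exact h

end Literature.MathematicalPhysics.QuantumFieldTheory.Balaban1983to89.B9Eq343CutoffFamilyZd

end
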